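import Literature.NumberTheory.LFunctions.ThetaChainSound
import Mathlib.NumberTheory.Chebyshev
import HarnessLib

/-!
# Schoenfeld's `|ψ(x) − x| < √x log² x/(8π)` on `73 ≤ x < 65538` by kernel computation

Topic: `Literature/NumberTheory/LFunctions`. THEOREMS (everything proved; one `decide +kernel`
evaluation of about `35 s`). First step of the discharge of the named fact
`Literature.NumberTheory.LFunctions.Schoenfeld1976_psi` (`SchoenfeldExplicit.lean`; L. Schoenfeld,
*Sharper bounds for the Chebyshev functions θ(x) and ψ(x). II*, Math. Comp. 30 (1976), Thm. 10,
(6.2): under RH, `|ψ(x) − x| < √x log² x/(8π)` for `x ≥ 73.2`). Schoenfeld settles the small `x`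
by tables (proof of Thm. 10, p. 339: Gram's Table VII below `1075`, Rosser–Schoenfeld 1962,
Thms. 18 and 24, `θ(x) < x`, up to `e¹⁶`); on a finite range the inequality is a statement about
finitely many prime powers and needs no hypothesis. Here the range **`73 ≤ x < 65538`** is
certified by the kernel, walking **every integer** `n = 3, …, 65537`:

* `classify n` decides whether `n` is a prime power and finds its prime: even `n` are stripped of
  their factors `2` (`strip`, `finish`); an odd `n` is prime iff `ThetaChain.primeChk n` (trial
  division below `2143`, one `gcd` with `ChainTable.sieveModulus = ∏_{3 ≤ q ≤ 2143} q` above; valid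
  for odd `n < 2153²`); otherwise the first entry of `ChainTable.smallOddPrimes` dividing `n`
  (`firstDiv`) is its least odd prime factor `q` (the list is increasing and contains every odd prime
  `≤ 2143`, `ThetaChain.smallOddPrimes_spec`), and `n` is a prime power iff stripping `q` leaves `1`
  (`classify_sound`: the answer `(p, k)`, `k ≥ 1`, certifies `n = p^k` with `p` prime, the answer
  `(1, 0)` certifies `Λ(n) = 0`);
* the state carries the last prime `pr` with `Lplo ≤ 2⁸⁰ log pr ≤ Lphi` (extended to the next prime
  by the short series `ThetaChain.logNext`), the last prime power `q` with `Lq ≤ 2⁸⁰ log q`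
  (`k·lo(p)` for `q = p^k`, `ChainCheck.logN` for `k ≥ 2`), and `plo ≤ 2⁸⁰ ψ(n) ≤ phi`
  (`ψ(n) = ψ(n−1) + Λ(n)`);
* on every cell `[n, n+1)` with `n ≥ 73` the two comparisons `2⁸⁰(n+1) − plo ≤ 2⁸⁰ B(q)` and
  `phi + 1 − 2⁸⁰ n ≤ 2⁸⁰ B(q)` (`chkOK`, through `ThetaChain.chkB`, i.e. after squaring, with
  `64π² < 631.66`), where `B(q) = √q log² q/(8π) ≤ B(x)` on the cell (`B = ThetaChain.bnd`,
  `ThetaChain.bnd_mono`): they give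
  `x − ψ(x) < n + 1 − ψ(n) ≤ B(x)` and `ψ(x) − x ≤ ψ(n) − n < B(x)`.

Main results: `run_all` (the kernel fact: the run from `n = 3` to `65537` succeeds), `run_sound`
(the invariant `Inv` along a successful run) and

* `abs_psi_sub_lt_small` — **for all real `73 ≤ x < 65538`, `|ψ(x) − x| < √x log² x/(8π)`**
  (unconditionally; numerically the two-sided bound already holds from `x = 59`, where the lower
  side (6.4) starts — Schoenfeld's `73.2` is not optimal — but only the printed range is certified).

Soundness proofs and the kernel: `ThetaChain.chkB` multiplies by the numerals `2¹⁶⁰`, `6316548210`,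
`10⁷`; the kernel must never be led to unfold it at symbolic arguments (comparing a `Bool`
constructor with an `&&`/`||` of `chkB`-terms makes it unroll `Nat.mul x 2¹⁶⁰`: "excessive memory"),
so `Bool` facts are only extracted from a passed check by lemmas keyed on its syntactic shape
(`bif_some`, `Bool.or_eq_true`, `Bool.and_eq_true`).

The ranges `x ≥ 65536 = 16⁴` are analytic (explicit formula under RH: `SchoenfeldPsiMid.lean` and
the tree's `SchoenfeldThetaMid.lean`, `SchoenfeldThetaLarge.lean`).

## References

* L. Schoenfeld, *Sharper bounds for the Chebyshev functions θ(x) and ψ(x). II*, Math. Comp. 30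
  (1976), 337–360, Thm. 10 (6.2), (6.4), (6.17) and the proof on p. 339. [Schoenfeld1976]
* J. B. Rosser, L. Schoenfeld, *Approximate formulas for some functions of prime numbers*, Illinois
  J. Math. 6 (1962), 64–94, Thms. 18, 24 (the tables used by Schoenfeld). [RosserSchoenfeld1962]
-/

noncomputable section

open Real ArithmeticFunction
open scoped Chebyshev

namespace Literature.NumberTheory.LFunctions

namespace PsiChain

open ChainCheck ChainTable ThetaChain

/-! ## The checker (computable core; all arithmetic on the kernel's `Nat` primitives) -/

/-- The first entry of the list dividing `n` (`0` if there is none). [folklore] -/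
def firstDiv : List ℕ → ℕ → ℕ
  | [], _ => 0
  | q :: t, n => bif Nat.beq (Nat.mod n q) 0 then q else firstDiv t n

/-- Strip the powers of `p`, counting them: from `(m, j)` to `(m', j')` with `m = p^{j'−j} m'`
(fuelled; an exhausted fuel only leaves `p ∣ m'`, which the caller detects). [folklore] -/
def strip (p : ℕ) : ℕ → ℕ → ℕ → ℕ × ℕ
  | 0, m, j => (m, j)
  | fuel + 1, m, j =>
      bif Nat.beq (Nat.mod m p) 0 then strip p fuel (Nat.div m p) (Nat.add j 1) else (m, j)

/-- From a prime `p ∣ n`: `(p, k)` when `n = p^k`; `(1, 0)` when `n = p^j m'` with `m' > 1`,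
`p ∤ m'` (so `n` is not a prime power); `(0, 0)` (failure) otherwise. [folklore] -/
def finish (p n : ℕ) : ℕ × ℕ :=
  match strip p 64 n 0 with
  | (m, j) => bif Nat.beq m 1 then (p, j) else bif Nat.beq (Nat.mod m p) 0 then (0, 0) else (1, 0)

/-- **Classification of `2 ≤ n < 2153²`**: `(p, k)` with `k ≥ 1` certifies `n = p^k`, `p` prime;
`(p, 0)` with `p ≠ 0` certifies that `n` is not a prime power; `(0, 0)` is a failure. Even `n`:
strip the twos. Odd `n`: prime iff `ThetaChain.primeChk`; else its least odd prime factor is the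
first entry of `ChainTable.smallOddPrimes` dividing it. [folklore] -/
def classify (n : ℕ) : ℕ × ℕ :=
  bif Nat.beq (Nat.mod n 2) 0 then finish 2 n
  else bif primeChk n then (n, 1)
  else
    let q := firstDiv smallOddPrimes n
    bif Nat.beq q 0 then (0, 0) else finish q n

/-- A state of the `ψ`-walk at an integer `n`: the last prime `pr ≤ n` with
`Lplo ≤ 2⁸⁰ log pr ≤ Lphi`, the last prime power `q ≤ n` with `Lq ≤ 2⁸⁰ log q`, and
`plo ≤ 2⁸⁰ ψ(n) ≤ phi`. [folklore] -/
structure PS where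
  /-- the last prime reached -/
  pr : ℕ
  /-- lower bound of `2⁸⁰ log pr` -/
  Lplo : ℕ
  /-- upper bound of `2⁸⁰ log pr` -/
  Lphi : ℕ
  /-- the last prime power reached -/
  q : ℕ
  /-- lower bound of `2⁸⁰ log q` -/
  Lq : ℕ
  /-- lower bound of `2⁸⁰ ψ(n)` -/
  plo : ℕ
  /-- upper bound of `2⁸⁰ ψ(n)` -/
  phi : ℕ
  deriving DecidableEq

/-- **The update at the integer `n`**: classify `n`; at a prime extend the logarithm by
`ThetaChain.logNext`, at a higher prime power `p^k` take `ChainCheck.logN p`; the enclosure of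
`ψ(n) = ψ(n−1) + Λ(n)` gains `[lo(p), hi(p)]`, the last prime power becomes `n` with `Lq = k·lo(p)`.
`none` on a failed classification or logarithm. [folklore] -/
def update (s : PS) (n : ℕ) : Option PS :=
  match s with
  | ⟨pr, Lplo, Lphi, q, Lq, plo, phi⟩ =>
    match classify n with
    | (p, k) =>
      bif Nat.beq p 0 then none else
      bif Nat.beq k 0 then some ⟨pr, Lplo, Lphi, q, Lq, plo, phi⟩ else
      bif Nat.beq k 1 then
        (match logNext pr Lplo Lphi n with
         | none => none
         | some (l, h) => some ⟨n, l, h, n, l, Nat.add plo l, Nat.add phi h⟩)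
      else
        match logN p with
        | none => none
        | some (l, h) => some ⟨pr, Lplo, Lphi, n, Nat.mul k l, Nat.add plo l, Nat.add phi h⟩

/-- **The two comparisons on the cell `[n, n+1)`** (vacuous below `n₀`): `2⁸⁰(n+1) − plo ≤ 2⁸⁰ B(q)`
and `phi + 1 − 2⁸⁰ n ≤ 2⁸⁰ B(q)`, `B(q) = √q log² q/(8π)` bounded below through `Lq`
(`ThetaChain.chkB`). [folklore] -/
def chkOK (n0 n : ℕ) (s : PS) : Bool :=
  match s with
  | ⟨_, _, _, q, Lq, plo, phi⟩ =>
    Nat.blt n n0 || (chkB (Nat.sub (Nat.mul SC (Nat.add n 1)) plo) q Lq &&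
      chkB (Nat.sub (Nat.add phi 1) (Nat.mul SC n)) q Lq)

/-- **One step**, processing the integer `n`: the update, then the two comparisons. [folklore] -/
def step (n0 : ℕ) (s : PS) (n : ℕ) : Option PS :=
  match update s n with
  | none => none
  | some s' => bif chkOK n0 n s' then some s' else none

/-- **The run**: `fuel` consecutive integers starting with `n`; fails as soon as a step fails.
[folklore] -/
def run (n0 : ℕ) : ℕ → ℕ → PS → Option PS
  | 0, _, s => some s
  | fuel + 1, n, s =>
    match step n0 s n with
    | none => none
    | some s' => run n0 fuel (Nat.add n 1) s'

/-- The initial state, at `n = 2`: `pr = q = 2`, `ψ(2) = log 2`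
(`ChainCheck.L2LON ≤ 2⁸⁰ log 2 ≤ ChainCheck.L2HIN`). [folklore] -/
def initS : PS := ⟨2, L2LON, L2HIN, 2, L2LON, L2LON, L2HIN⟩

/-- **The kernel fact**: the run over `n = 3, …, 65537` with the comparisons from `n₀ = 73` on
succeeds (about `35 s` of kernel time: one `gcd` per odd integer, a short logarithmic series per
prime, two squared comparisons per integer). [cite: Schoenfeld1976, Thm. 10 (6.2), proof p. 339] -/
theorem run_all : (run 73 65535 3 initS).isSome = true := by
  decide +kernel

/-! ## Soundness of the classification -/

/-- `strip`: the result `(m', j')` satisfies `j' = j + i` and `m = p^i m'` for some `i`. [folklore] -/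
theorem strip_spec (p : ℕ) : ∀ (fuel m j : ℕ),
    ∃ i : ℕ, (strip p fuel m j).2 = j + i ∧ m = p ^ i * (strip p fuel m j).1
  | 0, m, j => ⟨0, by simp [strip]⟩
  | fuel + 1, m, j => by
      simp only [strip]
      cases hb : Nat.beq (Nat.mod m p) 0 with
      | false => exact ⟨0, by simp⟩
      | true =>
        simp only [cond_true]
        have hdvd : p ∣ m := Nat.dvd_of_mod_eq_zero (Nat.eq_of_beq_eq_true hb)
        obtain ⟨i, h1, h2⟩ := strip_spec p fuel (Nat.div m p) (Nat.add j 1)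
        have h2' : m / p = p ^ i * (strip p fuel (Nat.div m p) (Nat.add j 1)).1 := h2
        refine ⟨i + 1, by rw [h1]; exact (Nat.add_assoc j 1 i).trans (by rw [Nat.add_comm 1 i]), ?_⟩
        calc m = p * (m / p) := (Nat.mul_div_cancel' hdvd).symm
          _ = p * (p ^ i * (strip p fuel (Nat.div m p) (Nat.add j 1)).1) := by rw [← h2']
          _ = p ^ (i + 1) * (strip p fuel (Nat.div m p) (Nat.add j 1)).1 := by ring

/-- If `n = p^j m` with `p` prime, `p ∣ n`, `m ≠ 1` and `p ∤ m`, then `n` is not a prime power.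
[folklore] -/
theorem not_isPrimePow_of_factor {p n m j : ℕ} (hp : p.Prime) (hn : n = p ^ j * m) (hm1 : m ≠ 1)
    (hpm : ¬ p ∣ m) (hpn : p ∣ n) : ¬ IsPrimePow n := by
  intro hpp
  obtain ⟨r, k, hr, hk, rfl⟩ := (isPrimePow_nat_iff _).1 hpp
  have hpr : p = r := (Nat.prime_dvd_prime_iff_eq hp hr).1 (hp.dvd_of_dvd_pow hpn)
  subst hpr
  have hmd : m ∣ p ^ k := ⟨p ^ j, by rw [hn]; ring⟩
  obtain ⟨i, -, rfl⟩ := (Nat.dvd_prime_pow hp).1 hmd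
  rcases i with _ | i
  · exact hm1 (by simp)
  · exact hpm (dvd_pow_self p (Nat.succ_ne_zero i))

/-- **Soundness of `finish`** for a prime `p ∣ n`, `n ≥ 2`: a non-failing answer `(p', k)` has either
`k ≠ 0`, `p' = p`, `n = p^k`, or `k = 0` and `n` is not a prime power. [folklore] -/
theorem finish_sound {p n p' k : ℕ} (hp : p.Prime) (hpn : p ∣ n) (hn : 2 ≤ n)
    (hf : finish p n = (p', k)) (h0 : p' ≠ 0) :
    (k ≠ 0 ∧ p' = p ∧ n = p ^ k) ∨ (k = 0 ∧ ¬ IsPrimePow n) := by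
  obtain ⟨i, h1, h2⟩ := strip_spec p 64 n 0
  simp only [finish] at hf
  rcases hs : strip p 64 n 0 with ⟨m, j⟩
  rw [hs] at hf h1 h2
  simp only at hf h1 h2
  rw [Nat.zero_add] at h1
  subst h1
  cases hm : Nat.beq m 1 with
  | true =>
    rw [hm, cond_true, Prod.mk.injEq] at hf
    obtain ⟨rfl, rfl⟩ := hf
    have hm1 : m = 1 := Nat.eq_of_beq_eq_true hm
    rw [hm1, mul_one] at h2
    left
    refine ⟨?_, rfl, h2⟩
    rintro rfl
    rw [pow_zero] at h2
    omega
  | false =>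
    rw [hm, cond_false] at hf
    have hm1 : m ≠ 1 := fun h => by rw [h] at hm; exact Bool.noConfusion hm
    cases hpm : Nat.beq (Nat.mod m p) 0 with
    | true =>
      rw [hpm, cond_true, Prod.mk.injEq] at hf
      exact absurd hf.1.symm h0
    | false =>
      rw [hpm, cond_false, Prod.mk.injEq] at hf
      obtain ⟨-, rfl⟩ := hf
      right
      refine ⟨rfl, not_isPrimePow_of_factor hp h2 hm1 (fun hd => ?_) hpn⟩
      have : Nat.beq (Nat.mod m p) 0 = true := by
        rw [show Nat.mod m p = 0 from Nat.mod_eq_zero_of_dvd hd]; rfl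
      rw [this] at hpm
      exact Bool.noConfusion hpm

/-- **`firstDiv`** over an increasing list: a non-zero answer is the least entry dividing `n`.
[folklore] -/
theorem firstDiv_spec : ∀ (l : List ℕ) (n : ℕ), l.Pairwise (· < ·) → firstDiv l n ≠ 0 →
    firstDiv l n ∈ l ∧ firstDiv l n ∣ n ∧ ∀ e ∈ l, e ∣ n → firstDiv l n ≤ e
  | [], _, _, h => absurd rfl h
  | q :: t, n, hs, h => by
      rw [List.pairwise_cons] at hs
      simp only [firstDiv] at h ⊢
      cases hb : Nat.beq (Nat.mod n q) 0 with
      | true =>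
        simp only [cond_true]
        have hdvd : q ∣ n := Nat.dvd_of_mod_eq_zero (Nat.eq_of_beq_eq_true hb)
        refine ⟨List.mem_cons_self, hdvd, fun e he _ => ?_⟩
        rcases List.mem_cons.1 he with rfl | he
        · exact le_rfl
        · exact (hs.1 e he).le
      | false =>
        rw [hb] at h
        simp only [cond_false] at h ⊢
        obtain ⟨h1, h2, h3⟩ := firstDiv_spec t n hs.2 h
        refine ⟨List.mem_cons_of_mem _ h1, h2, fun e he hed => ?_⟩
        rcases List.mem_cons.1 he with rfl | he
        · exfalso
          have : Nat.beq (Nat.mod n e) 0 = true := by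
            rw [show Nat.mod n e = 0 from Nat.mod_eq_zero_of_dvd hed]; rfl
          rw [this] at hb
          exact Bool.noConfusion hb
        · exact h3 e he hed

/-- The first entry of `smallOddPrimes` dividing `n` is prime (a composite entry would be preceded by
its least prime factor, an odd prime `≤ 2143`, which is an entry). [folklore] -/
theorem firstDiv_prime {n : ℕ} (h : firstDiv smallOddPrimes n ≠ 0) :
    (firstDiv smallOddPrimes n).Prime ∧ firstDiv smallOddPrimes n ∣ n := by
  obtain ⟨hsorted, hmem3, hcomplete⟩ := smallOddPrimes_spec
  obtain ⟨hmem, hdvd, hmin⟩ := firstDiv_spec smallOddPrimes n hsorted h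
  refine ⟨?_, hdvd⟩
  obtain ⟨hd3, hdodd⟩ := hmem3 _ hmem
  have hdle : firstDiv smallOddPrimes n ≤ 2143 := (mem_smallOddPrimes_bounds _ hmem).2
  by_contra hnp
  have hlt : Nat.minFac (firstDiv smallOddPrimes n) < firstDiv smallOddPrimes n :=
    (Nat.not_prime_iff_minFac_lt (by omega)).1 hnp
  have hmp : (Nat.minFac (firstDiv smallOddPrimes n)).Prime := Nat.minFac_prime (by omega)
  have hmdvd : Nat.minFac (firstDiv smallOddPrimes n) ∣ firstDiv smallOddPrimes n := Nat.minFac_dvd _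
  have hmodd : Odd (Nat.minFac (firstDiv smallOddPrimes n)) := hdodd.of_dvd_nat hmdvd
  have hmmem := hcomplete _ hmp hmodd (by omega)
  have := hmin _ hmmem (hmdvd.trans hdvd)
  omega

/-- **Soundness of `classify`** for `2 ≤ n < 2153² = 4635409`: a non-failing answer `(p, k)` has
either `k ≠ 0`, `p` prime and `n = p^k`, or `k = 0` and `n` is not a prime power. [folklore] -/
theorem classify_sound {n p k : ℕ} (hn2 : 2 ≤ n) (hn : n < 4635409) (hc : classify n = (p, k))
    (h0 : p ≠ 0) : (k ≠ 0 ∧ p.Prime ∧ n = p ^ k) ∨ (k = 0 ∧ ¬ IsPrimePow n) := by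
  simp only [classify] at hc
  cases he : Nat.beq (Nat.mod n 2) 0 with
  | true =>
    rw [he, cond_true] at hc
    have h2n : 2 ∣ n := Nat.dvd_of_mod_eq_zero (Nat.eq_of_beq_eq_true he)
    rcases finish_sound Nat.prime_two h2n hn2 hc h0 with ⟨h1, rfl, h3⟩ | h
    · exact Or.inl ⟨h1, Nat.prime_two, h3⟩
    · exact Or.inr h
  | false =>
    rw [he, cond_false] at hc
    have hodd : Odd n := by
      rw [Nat.odd_iff]
      have : Nat.mod n 2 ≠ 0 := fun h => by rw [h] at he; exact Bool.noConfusion he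
      have h' : n % 2 ≠ 0 := this
      omega
    cases hpc : primeChk n with
    | true =>
      rw [hpc, cond_true, Prod.mk.injEq] at hc
      obtain ⟨rfl, rfl⟩ := hc
      exact Or.inl ⟨one_ne_zero, primeChk_sound hpc hodd hn, (pow_one _).symm⟩
    | false =>
      rw [hpc, cond_false] at hc
      cases hq : Nat.beq (firstDiv smallOddPrimes n) 0 with
      | true =>
        rw [hq, cond_true, Prod.mk.injEq] at hc
        exact absurd hc.1.symm h0
      | false =>
        rw [hq, cond_false] at hc
        have hq0 : firstDiv smallOddPrimes n ≠ 0 := fun h => by rw [h] at hq; exact Bool.noConfusion hq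
        obtain ⟨hqp, hqd⟩ := firstDiv_prime hq0
        rcases finish_sound hqp hqd hn2 hc h0 with ⟨h1, rfl, h3⟩ | h
        · exact Or.inl ⟨h1, hqp, h3⟩
        · exact Or.inr h

/-- `Λ(n)` from the classification: `log p` for the answer `(p, k)`, `k ≠ 0`; `0` for `(p, 0)`.
[folklore] -/
theorem vonMangoldt_of_classify {n p k : ℕ} (hn2 : 2 ≤ n) (hn : n < 4635409)
    (hc : classify n = (p, k)) (h0 : p ≠ 0) :
    (k ≠ 0 ∧ p.Prime ∧ n = p ^ k ∧ Λ n = Real.log p) ∨ (k = 0 ∧ Λ n = 0) := by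
  rcases classify_sound hn2 hn hc h0 with ⟨h1, h2, h3⟩ | ⟨h1, h2⟩
  · left
    refine ⟨h1, h2, h3, ?_⟩
    conv_lhs => rw [h3]
    rw [vonMangoldt_apply_pow h1, vonMangoldt_apply_prime h2]
  · exact Or.inr ⟨h1, vonMangoldt_eq_zero_iff.2 h2⟩

/-! ## Soundness of the run -/

/-- `ψ(n+1) = ψ(n) + Λ(n+1)` for natural `n`. [folklore] -/
theorem psi_natCast_succ (n : ℕ) : ψ ((n + 1 : ℕ) : ℝ) = ψ (n : ℝ) + Λ (n + 1) := by
  simp only [Chebyshev.psi, Nat.floor_natCast]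
  rw [Finset.sum_Ioc_succ_top (Nat.zero_le n)]

/-- `ψ(x) = ψ(n)` for `n ≤ x < n + 1`. [folklore] -/
theorem psi_eq_psi_nat {x : ℝ} {n : ℕ} (h1 : (n : ℝ) ≤ x) (h2 : x < n + 1) : ψ x = ψ (n : ℝ) := by
  have hx0 : 0 ≤ x := le_trans (Nat.cast_nonneg n) h1
  rw [Chebyshev.psi_eq_psi_coe_floor x]
  congr 2
  exact (Nat.floor_eq_iff hx0).2 ⟨h1, h2⟩

/-- `ψ(2) = log 2`. [folklore] -/
theorem psi_two : ψ ((2 : ℕ) : ℝ) = Real.log 2 := by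
  have hs : Finset.Ioc 0 2 = {1, 2} := by decide
  rw [Chebyshev.psi, Nat.floor_natCast, hs, Finset.sum_pair (by norm_num), vonMangoldt_apply_one,
    vonMangoldt_apply_prime Nat.prime_two, zero_add, Nat.cast_ofNat]

/-- A passed guard `bif c then some x else none = some y`. [folklore] -/
theorem bif_some {α : Type} {c : Bool} {x y : α} (h : (bif c then some x else none) = some y) :
    c = true ∧ x = y := by
  cases c <;> simp_all

/-- **Soundness of the update** from the integer `n` to `n + 1 < 2153²`: the bookkeeping passes to the
new state (`ψ(n+1) = ψ(n) + Λ(n+1)`, `Λ` from `vonMangoldt_of_classify`, the logarithms from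
`ThetaChain.logNext_sound` / `ChainCheck.logN_sound`). [folklore] -/
theorem update_sound {n pr Lplo Lphi q Lq plo phi : ℕ} {t : PS}
    (h : update ⟨pr, Lplo, Lphi, q, Lq, plo, phi⟩ (n + 1) = some t) (hn : n + 1 < 4635409)
    (hpr0 : 0 < pr) (hprn : pr ≤ n) (hLplo : (Lplo : ℝ) ≤ 2 ^ 80 * Real.log pr)
    (hLphi : 2 ^ 80 * Real.log pr ≤ Lphi) (hq1 : 1 ≤ q) (hqn : q ≤ n)
    (hLq : (Lq : ℝ) ≤ 2 ^ 80 * Real.log q) (hlo : (plo : ℝ) ≤ 2 ^ 80 * ψ (n : ℝ))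
    (hhi : 2 ^ 80 * ψ (n : ℝ) ≤ phi) :
    (0 < t.pr ∧ t.pr ≤ n + 1 ∧ (t.Lplo : ℝ) ≤ 2 ^ 80 * Real.log t.pr ∧
        2 ^ 80 * Real.log t.pr ≤ t.Lphi) ∧
      (1 ≤ t.q ∧ t.q ≤ n + 1 ∧ (t.Lq : ℝ) ≤ 2 ^ 80 * Real.log t.q) ∧
      ((t.plo : ℝ) ≤ 2 ^ 80 * ψ ((n + 1 : ℕ) : ℝ) ∧ 2 ^ 80 * ψ ((n + 1 : ℕ) : ℝ) ≤ t.phi) := by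
  have hn2 : 2 ≤ n + 1 := by omega
  have hψ := psi_natCast_succ n
  simp only [update] at h
  rcases hc : classify (n + 1) with ⟨p, k⟩
  rw [hc] at h
  simp only at h
  cases hp0 : Nat.beq p 0 with
  | true => rw [hp0, cond_true] at h; exact absurd h (by simp)
  | false =>
    rw [hp0, cond_false] at h
    have hp0' : p ≠ 0 := fun hh => by rw [hh] at hp0; exact Bool.noConfusion hp0
    have hΛ := vonMangoldt_of_classify hn2 hn hc hp0'
    cases hk0 : Nat.beq k 0 with
    | true =>
      -- not a prime power: `ψ(n+1) = ψ(n)`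
      rw [hk0, cond_true, Option.some.injEq] at h
      subst h
      have hk : k = 0 := Nat.eq_of_beq_eq_true hk0
      have hΛ0 : Λ (n + 1) = 0 := by
        rcases hΛ with ⟨h1, -⟩ | ⟨-, h2⟩
        · exact absurd hk h1
        · exact h2
      rw [hΛ0, add_zero] at hψ
      rw [hψ]
      exact ⟨⟨hpr0, (by show pr ≤ n + 1; omega), hLplo, hLphi⟩,
        ⟨hq1, (by show q ≤ n + 1; omega), hLq⟩, ⟨hlo, hhi⟩⟩
    | false =>
      rw [hk0, cond_false] at h
      have hk : k ≠ 0 := fun hh => by rw [hh] at hk0; exact Bool.noConfusion hk0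
      obtain ⟨-, hpp, hnpk, hΛp⟩ : k ≠ 0 ∧ p.Prime ∧ n + 1 = p ^ k ∧ Λ (n + 1) = Real.log p := by
        rcases hΛ with h1 | ⟨h2, -⟩
        · exact h1
        · exact absurd h2 hk
      rw [hΛp] at hψ
      cases hk1 : Nat.beq k 1 with
      | true =>
        -- a prime: `n + 1 = p`
        rw [hk1, cond_true] at h
        have hk' : k = 1 := Nat.eq_of_beq_eq_true hk1
        rw [hk', pow_one] at hnpk
        rcases hln : logNext pr Lplo Lphi (n + 1) with _ | ⟨l, h'⟩
        · rw [hln] at h; exact absurd h (by simp)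
        · rw [hln] at h
          simp only [Option.some.injEq] at h
          subst h
          obtain ⟨hl1, hl2⟩ := logNext_sound hln hpr0 (by omega) hLplo hLphi
          have hlogp : Real.log (p : ℝ) = Real.log ((n + 1 : ℕ) : ℝ) := by rw [hnpk]
          rw [hlogp] at hψ
          refine ⟨⟨Nat.succ_pos n, le_rfl, hl1, hl2⟩, ⟨(by show 1 ≤ n + 1; omega), le_rfl, hl1⟩,
            ?_, ?_⟩
          · show ((Nat.add plo l : ℕ) : ℝ) ≤ 2 ^ 80 * ψ ((n + 1 : ℕ) : ℝ)
            rw [Nat.add_eq, Nat.cast_add plo l, hψ]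
            linarith
          · show 2 ^ 80 * ψ ((n + 1 : ℕ) : ℝ) ≤ ((Nat.add phi h' : ℕ) : ℝ)
            rw [Nat.add_eq, Nat.cast_add phi h', hψ]
            linarith
      | false =>
        -- a higher prime power `n + 1 = p^k`
        rw [hk1, cond_false] at h
        rcases hln : logN p with _ | ⟨l, h'⟩
        · rw [hln] at h; exact absurd h (by simp)
        · rw [hln] at h
          simp only [Option.some.injEq] at h
          subst h
          obtain ⟨hl1, hl2, -⟩ := logN_sound hln
          have hlogq : Real.log ((n + 1 : ℕ) : ℝ) = k * Real.log p := by
            rw [hnpk, Nat.cast_pow, Real.log_pow]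
          refine ⟨⟨hpr0, (by show pr ≤ n + 1; omega), hLplo, hLphi⟩,
            ⟨(by show 1 ≤ n + 1; omega), le_rfl, ?_⟩, ?_, ?_⟩
          · show ((Nat.mul k l : ℕ) : ℝ) ≤ 2 ^ 80 * Real.log ((n + 1 : ℕ) : ℝ)
            rw [Nat.mul_eq, Nat.cast_mul k l, hlogq]
            have := mul_le_mul_of_nonneg_left hl1 (Nat.cast_nonneg k)
            linarith
          · show ((Nat.add plo l : ℕ) : ℝ) ≤ 2 ^ 80 * ψ ((n + 1 : ℕ) : ℝ)
            rw [Nat.add_eq, Nat.cast_add plo l, hψ]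
            linarith
          · show 2 ^ 80 * ψ ((n + 1 : ℕ) : ℝ) ≤ ((Nat.add phi h' : ℕ) : ℝ)
            rw [Nat.add_eq, Nat.cast_add phi h', hψ]
            linarith

/-- **Soundness of the two comparisons**: if `chkOK n₀ n t` passes and `n ≥ n₀`, the bound holds on
`[n, n+1)` (`ψ(x) = ψ(n)` there; `x − ψ(n) < n + 1 − ψ(n) ≤ B(q) ≤ B(x)` and
`ψ(n) − x ≤ ψ(n) − n < B(q) ≤ B(x)`). Only `Bool` facts are extracted from the check: the kernel is
never asked to unfold `ThetaChain.chkB` symbolically. [folklore] -/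
theorem chkOK_sound {n0 n : ℕ} {t : PS} (h : chkOK n0 n t = true) (hq1 : 1 ≤ t.q) (hqn : t.q ≤ n)
    (hLq : (t.Lq : ℝ) ≤ 2 ^ 80 * Real.log t.q) (hlo : (t.plo : ℝ) ≤ 2 ^ 80 * ψ (n : ℝ))
    (hhi : 2 ^ 80 * ψ (n : ℝ) ≤ t.phi) (hn0 : n0 ≤ n) {x : ℝ} (hx1 : (n : ℝ) ≤ x)
    (hx2 : x < n + 1) : |ψ x - x| < bnd x := by
  obtain ⟨pr, Lplo, Lphi, q, Lq, plo, phi⟩ := t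
  simp only at hq1 hqn hLq hlo hhi
  have h' : (Nat.blt n n0 || (chkB (Nat.sub (Nat.mul SC (Nat.add n 1)) plo) q Lq &&
      chkB (Nat.sub (Nat.add phi 1) (Nat.mul SC n)) q Lq)) = true := h
  rw [Bool.or_eq_true, Bool.and_eq_true] at h'
  rcases h' with hlt | ⟨hc1, hc2⟩
  · rw [Nat.blt_eq] at hlt
    omega
  · have hL : (((SC * (n + 1) - plo : ℕ)) : ℝ) ≤
        2 ^ 80 * (Real.sqrt q * Real.log q ^ 2 / (8 * Real.pi)) := chkB_sound hc1 hq1 hLq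
    have hU : (((phi + 1 - SC * n : ℕ)) : ℝ) ≤
        2 ^ 80 * (Real.sqrt q * Real.log q ^ 2 / (8 * Real.pi)) := chkB_sound hc2 hq1 hLq
    have h1 := real_sub_le_natSub (SC * (n + 1)) plo
    have h2 := real_sub_le_natSub (phi + 1) (SC * n)
    push_cast at h1 h2
    rw [SC_real] at h1 h2
    have hqR : (1 : ℝ) ≤ q := by exact_mod_cast hq1
    have hqx : (q : ℝ) ≤ x := le_trans (by exact_mod_cast hqn) hx1
    have hBB : bnd q ≤ bnd x := bnd_mono hqR hqx
    have hψ : ψ x = ψ (n : ℝ) := psi_eq_psi_nat hx1 hx2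
    have h80 : (0 : ℝ) < 2 ^ 80 := by positivity
    rw [hψ, abs_sub_lt_iff]
    constructor
    · -- `ψ(n) − x ≤ ψ(n) − n < B(q) ≤ B(x)`
      have h3 : 2 ^ 80 * (ψ (n : ℝ) - n) < 2 ^ 80 * bnd q := by unfold bnd; linarith
      have h4 : ψ (n : ℝ) - n < bnd q := lt_of_mul_lt_mul_left h3 h80.le
      linarith
    · -- `x − ψ(n) < n + 1 − ψ(n) ≤ B(q) ≤ B(x)`
      have h3 : 2 ^ 80 * ((n : ℝ) + 1 - ψ (n : ℝ)) ≤ 2 ^ 80 * bnd q := by unfold bnd; linarith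
      have h4 : (n : ℝ) + 1 - ψ (n : ℝ) ≤ bnd q := le_of_mul_le_mul_left h3 h80
      linarith

/-- **The invariant** of the run at the integer `n` (comparisons from `n₀`): the bookkeeping of the
state and the bound on `[n₀, n+1)`. [folklore] -/
def Inv (n0 n : ℕ) (s : PS) : Prop :=
  (0 < s.pr ∧ s.pr ≤ n ∧ (s.Lplo : ℝ) ≤ 2 ^ 80 * Real.log s.pr ∧ 2 ^ 80 * Real.log s.pr ≤ s.Lphi) ∧
  (1 ≤ s.q ∧ s.q ≤ n ∧ (s.Lq : ℝ) ≤ 2 ^ 80 * Real.log s.q) ∧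
  ((s.plo : ℝ) ≤ 2 ^ 80 * ψ (n : ℝ) ∧ 2 ^ 80 * ψ (n : ℝ) ≤ s.phi) ∧
  ∀ x : ℝ, (n0 : ℝ) ≤ x → x < n + 1 → |ψ x - x| < bnd x

/-- **Soundness of one step**: the invariant passes from `n` to `n + 1` (`n + 1 < 2153²`). [folklore] -/
theorem step_sound {n0 n : ℕ} {s s' : PS} (hI : Inv n0 n s) (h : step n0 s (n + 1) = some s')
    (hn : n + 1 < 4635409) : Inv n0 (n + 1) s' := by
  obtain ⟨pr, Lplo, Lphi, q, Lq, plo, phi⟩ := s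
  obtain ⟨⟨hpr0, hprn, hLplo, hLphi⟩, ⟨hq1, hqn, hLq⟩, ⟨hlo, hhi⟩, hcov⟩ := hI
  simp only at hpr0 hprn hLplo hLphi hq1 hqn hLq hlo hhi
  simp only [step] at h
  rcases hu : update ⟨pr, Lplo, Lphi, q, Lq, plo, phi⟩ (n + 1) with _ | t
  · rw [hu] at h; exact absurd h (by simp)
  · rw [hu] at h
    simp only at h
    obtain ⟨hok, rfl⟩ := bif_some h
    obtain ⟨⟨h1, h2, h3, h4⟩, ⟨h5, h6, h7⟩, ⟨h8, h9⟩⟩ :=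
      update_sound hu hn hpr0 hprn hLplo hLphi hq1 hqn hLq hlo hhi
    refine ⟨⟨h1, h2, h3, h4⟩, ⟨h5, h6, h7⟩, ⟨h8, h9⟩, fun x hx0 hx2 => ?_⟩
    rcases lt_or_ge x ((n : ℝ) + 1) with hx1 | hx1
    · exact hcov x hx0 hx1
    · have hx1' : ((n + 1 : ℕ) : ℝ) ≤ x := by push_cast; exact hx1
      have hn0 : n0 ≤ n + 1 := by
        by_contra hh
        have : ((n + 1 : ℕ) : ℝ) + 1 ≤ n0 := by exact_mod_cast (by omega : n + 1 + 1 ≤ n0)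
        linarith
      exact chkOK_sound hok h5 h6 h7 h8 h9 hn0 hx1' hx2

/-- **Soundness of the run**: the invariant passes from `n` to `n + fuel` (`n + fuel < 2153²`).
[folklore] -/
theorem run_sound {n0 : ℕ} : ∀ (fuel n : ℕ) (s s' : PS), Inv n0 n s →
    run n0 fuel (n + 1) s = some s' → n + fuel < 4635409 → Inv n0 (n + fuel) s'
  | 0, n, s, s', hI, h, _ => by
      simp only [run, Option.some.injEq] at h
      subst h
      simpa using hI
  | fuel + 1, n, s, s', hI, h, hn => by
      simp only [run, Nat.add_eq] at h
      rcases hst : step n0 s (n + 1) with _ | s₁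
      · rw [hst] at h; exact absurd h (by simp)
      · rw [hst] at h
        simp only at h
        have hI1 := step_sound hI hst (by omega)
        have := run_sound fuel (n + 1) s₁ s' hI1 h (by omega)
        rwa [show n + 1 + fuel = n + (fuel + 1) by omega] at this

/-- The invariant holds initially (`n = 2`, `n₀ = 73`). [folklore] -/
theorem initS_inv : Inv 73 2 initS := by
  have h1 := L2LON_le
  have h2 := le_L2HIN
  have hψ2 : ψ ((2 : ℕ) : ℝ) = Real.log 2 := psi_two
  refine ⟨⟨by norm_num [initS], le_rfl, ?_, ?_⟩, ⟨by norm_num [initS], le_rfl, ?_⟩, ⟨?_, ?_⟩, ?_⟩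
  · simpa [initS] using h1
  · simpa [initS] using h2
  · simpa [initS] using h1
  · rw [hψ2]; simpa [initS] using h1
  · rw [hψ2]; simpa [initS] using h2
  · intro x hx1 hx2
    norm_num at hx1 hx2
    linarith

/-- **Schoenfeld's (6.2) on `73 ≤ x < 65538`, unconditionally, by kernel computation**:
`|ψ(x) − x| < √x log² x/(8π)`. [cite: Schoenfeld1976, Thm. 10 (6.2)] -/
theorem abs_psi_sub_lt_small {x : ℝ} (h1 : 73 ≤ x) (h2 : x < 65538) :
    |ψ x - x| < Real.sqrt x * Real.log x ^ 2 / (8 * Real.pi) := by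
  obtain ⟨s', hs'⟩ := Option.isSome_iff_exists.1 run_all
  have hI := run_sound (n0 := 73) 65535 2 initS s' initS_inv hs' (by norm_num)
  have := hI.2.2.2 x (by exact_mod_cast h1) (by norm_num; exact h2)
  exact this

end PsiChain

end Literature.NumberTheory.LFunctions

end
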